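import Mathlib.Analysis.Calculus.MeanValue
import Mathlib.Analysis.SpecialFunctions.Pow.Deriv
import Mathlib.Analysis.SpecialFunctions.Pow.Continuity
import HarnessLib

/-!
# The sharp local bound for the power-law differential inequality `y' ≤ C y^p`, `p > 1`

Analysis/ODE proof file (theorems only). Companion of `SuperlinearLocalBound.lean` (the case `p = 3/2`)
and `SuperlinearDampedDecay.lean`: the general exponent, covering in one statement the three scalar
closures that recur in energy-method arguments — the cubic enstrophy law `X' ≤ cX³` of strong-solution
local existence (Robinson–Rodrigo–Sadowski 2016, proof of Thm 6.8, (6.8): comparison with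
`dX/dt = cX³`, `X(t) = X₀/√(1 − 2ctX₀²)`; Exercise 6.2 is the comparison principle itself), the
`E' ≤ C E^{3/2}` laws of claimed regularity proofs (cell `ns-claims`, D-0090), and Riccati `y' ≤ K y²`.

* `le_profile_of_deriv_le_rpow` — if `y ≥ 0` is continuous on `[0,b]` with right derivatives `y'` on
  `[0,b)`, `y' ≤ C y^p` there (`C ≥ 0`, `p > 1`), and the horizon condition
  `(p − 1)·C·y(0)^{p−1}·b < 1` holds, then on `[0,b]`
  `y t ≤ y 0 · (1 − (p−1) C y(0)^{p−1} t)^{−1/(p−1)}` — the SHARP majorant (it solves `Y' = C Y^p`,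
  `Y(0) = y(0)`). Proof: fencing (`image_le_of_deriv_right_lt_deriv_boundary'`) against the profiles with
  `(C, y 0)` replaced by `(C+ε, y 0+ε)`, then `ε ↓ 0`.
* `hasDerivAt_powerLawProfile` — the profile `Y(t) = A(1 − (p−1) K A^{p−1} t)^{−1/(p−1)}` solves
  `Y' = K Y^p` wherever the bracket is positive (sharpness: the bound is attained, and `Y` is unbounded
  at the horizon `1/((p−1) K A^{p−1})`, so nothing horizon-free follows from the law).
* `le_div_sqrt_of_deriv_le_cube` — the instance `p = 3` in the book's form:
  `X' ≤ c X³ ⇒ X(t) ≤ X(0)/√(1 − 2 c X(0)² t)`.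

[cite: RobinsonRodrigoSadowskiCUP2016, Exercise 6.2 (Ch. 6) with the proof of Thm 6.8, (6.8), §6.2 p.133–134 (comparison principle for X' ≤ cX³; general exponent p > 1 here)]

WHAT THIS IS NOT: not a claim about NS regularity or blow-up; not a claim about any author beyond the
typed locator.
-/

noncomputable section

open Set Filter Topology Real

namespace Literature.Analysis.ODE

/-- **The power-law profile solves the equality case.** For `A > 0`, `K > 0`, `p > 1` and
`d := 1 − (p−1) K A^{p−1} t > 0`, the function `Y(s) = A (1 − (p−1) K A^{p−1} s)^{−1/(p−1)}` has
`Y'(t) = K · Y(t)^p`. [cite: RobinsonRodrigoSadowskiCUP2016, Exercise 6.2 (Ch. 6) with the proof of Thm 6.8, (6.8), §6.2 p.133–134 (comparison principle for X' ≤ cX³; general exponent p > 1 here)] -/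
theorem hasDerivAt_powerLawProfile {A K p t : ℝ} (hA : 0 < A) (hK : 0 < K) (hp : 1 < p)
    (hd : 0 < 1 - (p - 1) * K * A ^ (p - 1) * t) :
    HasDerivAt (fun s : ℝ => A * (1 - (p - 1) * K * A ^ (p - 1) * s) ^ (-(1 / (p - 1))))
      (K * (A * (1 - (p - 1) * K * A ^ (p - 1) * t) ^ (-(1 / (p - 1)))) ^ p) t := by
  set k : ℝ := (p - 1) * K * A ^ (p - 1) with hk
  set q : ℝ := 1 / (p - 1) with hq
  have hp1 : 0 < p - 1 := by linarith
  have hApow : 0 < A ^ (p - 1) := Real.rpow_pos_of_pos hA _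
  have hkpos : 0 < k := by rw [hk]; positivity
  set d : ℝ := 1 - k * t with hd_def
  have hdpos : 0 < d := hd
  -- derivative of the bracket and of its power
  have hlin : HasDerivAt (fun s : ℝ => 1 - k * s) (-k) t := by
    have h1 : HasDerivAt (fun s : ℝ => k * s) (k * 1) t := (hasDerivAt_id t).const_mul k
    exact ((hasDerivAt_const t (1 : ℝ)).sub h1).congr_deriv (by ring)
  have hpow : HasDerivAt (fun s : ℝ => (1 - k * s) ^ (-q)) (-k * (-q) * (1 - k * t) ^ (-q - 1)) t :=
    hlin.rpow_const (Or.inl hdpos.ne')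
  have hB : HasDerivAt (fun s : ℝ => A * (1 - k * s) ^ (-q)) (A * (-k * (-q) * d ^ (-q - 1))) t :=
    hpow.const_mul A
  refine hB.congr_deriv ?_
  -- algebra: `A k q d^{−q−1} = K (A d^{−q})^p`
  have hqp : -q - 1 = (-q) * p := by
    rw [hq]; field_simp; ring
  have hrhs : K * (A * d ^ (-q)) ^ p = K * (A ^ p * d ^ ((-q) * p)) := by
    rw [Real.mul_rpow hA.le (Real.rpow_nonneg hdpos.le _), ← Real.rpow_mul hdpos.le]
  have hAp : A ^ p = A ^ (p - 1) * A := by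
    conv_lhs => rw [show p = (p - 1) + 1 by ring]
    rw [Real.rpow_add hA, Real.rpow_one]
  rw [hrhs, ← hqp, hAp]
  have hkq : k * q = K * A ^ (p - 1) := by
    rw [hk, hq]; field_simp
  calc A * (-k * -q * d ^ (-q - 1)) = A * (k * q) * d ^ (-q - 1) := by ring
    _ = A * (K * A ^ (p - 1)) * d ^ (-q - 1) := by rw [hkq]
    _ = K * (A ^ (p - 1) * A * d ^ (-q - 1)) := by ring

/-- **Sharp local bound for `y' ≤ C y^p`, `p > 1`** (fencing against the profiles of `Y' = (C+ε)Y^p`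
from `y(0)+ε`, `ε ↓ 0`): for `C ≥ 0`, `y ≥ 0` continuous on `[0,b]` with right derivatives `y'` on
`[0,b)`, `y' ≤ C y^p` there, and `(p−1)·C·y(0)^{p−1}·b < 1`, one has
`y t ≤ y 0 · (1 − (p−1)·C·y(0)^{p−1}·t)^{−1/(p−1)}` on `[0,b]`.
[cite: RobinsonRodrigoSadowskiCUP2016, Exercise 6.2 (Ch. 6) with the proof of Thm 6.8, (6.8), §6.2 p.133–134 (comparison principle for X' ≤ cX³; general exponent p > 1 here)] -/
theorem le_profile_of_deriv_le_rpow {y y' : ℝ → ℝ} {C b p : ℝ} (hp : 1 < p) (hC : 0 ≤ C)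
    (hy : ContinuousOn y (Icc 0 b)) (hy' : ∀ t ∈ Ico 0 b, HasDerivWithinAt y (y' t) (Ici t) t)
    (hnn : ∀ t ∈ Icc 0 b, 0 ≤ y t)
    (hineq : ∀ t ∈ Ico 0 b, y' t ≤ C * y t ^ p)
    (hhor : (p - 1) * C * y 0 ^ (p - 1) * b < 1) :
    ∀ t ∈ Icc 0 b, y t ≤ y 0 * (1 - (p - 1) * C * y 0 ^ (p - 1) * t) ^ (-(1 / (p - 1))) := by
  intro t ht
  have hb : 0 ≤ b := ht.1.trans ht.2
  have hy0 : 0 ≤ y 0 := hnn 0 ⟨le_rfl, hb⟩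
  have hp1 : 0 < p - 1 := by linarith
  -- the barrier inequality for every small `ε > 0`
  have hε : ∀ᶠ ε in 𝓝[>] (0 : ℝ),
      y t ≤ (y 0 + ε) * (1 - (p - 1) * (C + ε) * (y 0 + ε) ^ (p - 1) * t) ^ (-(1 / (p - 1))) := by
    have hcont : ContinuousAt (fun ε : ℝ => (p - 1) * (C + ε) * (y 0 + ε) ^ (p - 1) * b) 0 := by
      have h1 : ContinuousAt (fun ε : ℝ => (y 0 + ε) ^ (p - 1)) 0 :=
        ((continuous_const.add continuous_id).continuousAt).rpow_const (Or.inr hp1.le)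
      exact (((continuousAt_const.mul (continuousAt_const.add continuousAt_id)).mul h1).mul
        continuousAt_const)
    have hlt : ∀ᶠ ε in 𝓝 (0 : ℝ), (p - 1) * (C + ε) * (y 0 + ε) ^ (p - 1) * b < 1 := by
      refine hcont.eventually (gt_mem_nhds ?_)
      simpa using hhor
    have hpos : ∀ᶠ ε in 𝓝[>] (0 : ℝ), 0 < ε := eventually_mem_nhdsWithin
    filter_upwards [nhdsWithin_le_nhds hlt, hpos] with ε hε hεpos
    set A : ℝ := y 0 + ε with hA
    set K : ℝ := C + ε with hK
    have hApos : 0 < A := by rw [hA]; linarith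
    have hKpos : 0 < K := by rw [hK]; linarith
    set k : ℝ := (p - 1) * K * A ^ (p - 1) with hk
    have hkpos : 0 < k := by
      have := Real.rpow_pos_of_pos hApos (p - 1)
      rw [hk]; positivity
    have hden : ∀ s ∈ Icc 0 b, 0 < 1 - k * s := by
      intro s hs
      have h1 : k * s ≤ k * b := mul_le_mul_of_nonneg_left hs.2 hkpos.le
      have h2 : k * b < 1 := by simpa [hk, mul_assoc, mul_comm, mul_left_comm] using hε
      linarith
    set B : ℝ → ℝ := fun s => A * (1 - (p - 1) * K * A ^ (p - 1) * s) ^ (-(1 / (p - 1))) with hB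
    set B' : ℝ → ℝ := fun s => K * (B s) ^ p with hB'
    have hBd : ∀ s ∈ Icc 0 b, HasDerivAt B (B' s) s := fun s hs =>
      hasDerivAt_powerLawProfile hApos hKpos hp (by simpa [hk] using hden s hs)
    have hBpos : ∀ s ∈ Icc 0 b, 0 < B s := by
      intro s hs
      have := Real.rpow_pos_of_pos (by simpa [hk] using hden s hs : 0 < 1 - (p - 1) * K * A ^ (p - 1) * s)
        (-(1 / (p - 1)))
      simp only [hB]
      positivity
    have h0 : y 0 ≤ B 0 := by
      have : B 0 = A := by simp [hB]
      rw [this, hA]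
      linarith
    have hbound : ∀ s ∈ Ico 0 b, y s = B s → y' s < B' s := by
      intro s hs hEq
      have hBs := hBpos s (Ico_subset_Icc_self hs)
      have h1 : y' s ≤ C * (B s) ^ p := by simpa [hEq] using hineq s hs
      have h2 : C * (B s) ^ p < K * (B s) ^ p := by
        have : 0 < (B s) ^ p := Real.rpow_pos_of_pos hBs p
        rw [hK]; nlinarith
      simpa [hB'] using h1.trans_lt h2
    have key := image_le_of_deriv_right_lt_deriv_boundary' hy hy' h0
      (fun s hs => (hBd s hs).continuousAt.continuousWithinAt)
      (fun s hs => (hBd s (Ico_subset_Icc_self hs)).hasDerivWithinAt) hbound ht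
    simpa [hB, hA, hK] using key
  -- let `ε → 0⁺`
  have hd0 : 0 < 1 - (p - 1) * C * y 0 ^ (p - 1) * t := by
    have hk0 : 0 ≤ (p - 1) * C * y 0 ^ (p - 1) := by
      have := Real.rpow_nonneg hy0 (p - 1); positivity
    have h1 : (p - 1) * C * y 0 ^ (p - 1) * t ≤ (p - 1) * C * y 0 ^ (p - 1) * b :=
      mul_le_mul_of_nonneg_left ht.2 hk0
    linarith
  have hcont : ContinuousAt (fun ε : ℝ =>
      (y 0 + ε) * (1 - (p - 1) * (C + ε) * (y 0 + ε) ^ (p - 1) * t) ^ (-(1 / (p - 1)))) 0 := by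
    have h1 : ContinuousAt (fun ε : ℝ => (y 0 + ε) ^ (p - 1)) 0 :=
      ((continuous_const.add continuous_id).continuousAt).rpow_const (Or.inr hp1.le)
    have h2 : ContinuousAt (fun ε : ℝ => 1 - (p - 1) * (C + ε) * (y 0 + ε) ^ (p - 1) * t) 0 :=
      continuousAt_const.sub ((((continuousAt_const.mul (continuousAt_const.add continuousAt_id)).mul
        h1).mul continuousAt_const))
    have h3 : ContinuousAt (fun ε : ℝ =>
        (1 - (p - 1) * (C + ε) * (y 0 + ε) ^ (p - 1) * t) ^ (-(1 / (p - 1)))) 0 :=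
      h2.rpow_const (Or.inl (by simpa using hd0.ne'))
    exact (continuousAt_const.add continuousAt_id).mul h3
  have hlim : Tendsto (fun ε : ℝ =>
      (y 0 + ε) * (1 - (p - 1) * (C + ε) * (y 0 + ε) ^ (p - 1) * t) ^ (-(1 / (p - 1))))
      (𝓝[>] (0 : ℝ)) (𝓝 (y 0 * (1 - (p - 1) * C * y 0 ^ (p - 1) * t) ^ (-(1 / (p - 1))))) := by
    have h := hcont.tendsto
    simp only [add_zero] at h
    exact h.mono_left nhdsWithin_le_nhds
  exact ge_of_tendsto hlim hε

/-- **The cubic case in the book's form** (`p = 3`): if `X ≥ 0` is continuous on `[0,b]` with right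
derivatives `X'`, `X' ≤ c X³` on `[0,b)` (`c ≥ 0`) and `2 c X(0)² b < 1`, then
`X t ≤ X 0 / √(1 − 2 c X(0)² t)` on `[0,b]` — the comparison function of RRS (6.8).
[cite: RobinsonRodrigoSadowskiCUP2016, Exercise 6.2 (Ch. 6) with the proof of Thm 6.8, (6.8), §6.2 p.133–134 (comparison principle for X' ≤ cX³; general exponent p > 1 here)] -/
theorem le_div_sqrt_of_deriv_le_cube {X X' : ℝ → ℝ} {c b : ℝ} (hc : 0 ≤ c)
    (hX : ContinuousOn X (Icc 0 b)) (hX' : ∀ t ∈ Ico 0 b, HasDerivWithinAt X (X' t) (Ici t) t)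
    (hnn : ∀ t ∈ Icc 0 b, 0 ≤ X t)
    (hineq : ∀ t ∈ Ico 0 b, X' t ≤ c * X t ^ 3)
    (hhor : 2 * c * X 0 ^ 2 * b < 1) :
    ∀ t ∈ Icc 0 b, X t ≤ X 0 / Real.sqrt (1 - 2 * c * X 0 ^ 2 * t) := by
  intro t ht
  have hb : 0 ≤ b := ht.1.trans ht.2
  have hX0 : 0 ≤ X 0 := hnn 0 ⟨le_rfl, hb⟩
  have h3 : (1 : ℝ) < 3 := by norm_num
  have hineq' : ∀ s ∈ Ico 0 b, X' s ≤ c * X s ^ (3 : ℝ) := fun s hs => by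
    simpa [Real.rpow_natCast] using hineq s hs
  have hpow2 : X 0 ^ ((3 : ℝ) - 1) = X 0 ^ 2 := by
    rw [show (3 : ℝ) - 1 = (2 : ℕ) by norm_num, Real.rpow_natCast]
  have hhor' : ((3 : ℝ) - 1) * c * X 0 ^ ((3 : ℝ) - 1) * b < 1 := by
    rw [hpow2]; nlinarith
  have key := le_profile_of_deriv_le_rpow h3 hc hX hX' hnn hineq' hhor' t ht
  rw [hpow2] at key
  have hd : 0 < 1 - 2 * c * X 0 ^ 2 * t := by
    have h1 : 2 * c * X 0 ^ 2 * t ≤ 2 * c * X 0 ^ 2 * b :=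
      mul_le_mul_of_nonneg_left ht.2 (by positivity)
    linarith
  have hexp : (1 - ((3 : ℝ) - 1) * c * X 0 ^ 2 * t) ^ (-(1 / ((3 : ℝ) - 1))) =
      (Real.sqrt (1 - 2 * c * X 0 ^ 2 * t))⁻¹ := by
    rw [show ((3 : ℝ) - 1) * c * X 0 ^ 2 * t = 2 * c * X 0 ^ 2 * t by ring,
      show (-(1 / ((3 : ℝ) - 1))) = -(1 / 2 : ℝ) by norm_num, Real.rpow_neg hd.le,
      Real.sqrt_eq_rpow]
  rw [hexp, ← div_eq_mul_inv] at key
  exact key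

end Literature.Analysis.ODE

end
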